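import Literature.Analysis.FluidPDE.LeiZhang2011Energy
import Literature.Analysis.FluidPDE.LeiZhang2011AxisSlice
import HarnessLib

/-!
# Lei–Zhang 2011: the localized energy identity with the axis boundary term

Analysis/FluidPDE proofs file (theorems only), on the discharge path of the named fact
`Literature.Analysis.FluidPDE.LeiZhang2011_liouville` (Z. Lei, Q. S. Zhang, J. Funct. Anal. 261
(2011) = arXiv:1011.5066). The space–time energy identity of `LeiZhang2011Energy`
(`LeiZhang2011.energy_identity`) assumed that the tested function vanishes on the symmetry axis
(so that the axis term `(2/r)∂ᵣ` integrates by parts without boundary). In §3 of the paper the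
equation (1.5) is tested for `Φ = 2(M − Γ)/J`, which is a constant `a ≥ 1` on the axis, and the
axis term produces boundary contributions (proof of Lemma 3.2, p. 9: "`−∫(4π/r)∂ᵣΨζ² r dr dθ dz
= −4π∫(Ψ − Ψ̄)ζ² dz|_{r=0}^{r=∞} + …`"; proof of Lemma 3.4, p. 11). This file records the identity
in that generality (`LeiZhang2011.energy_identity_axis`):

`∫ (H(F(t₂))η(t₂) − H(F(t₁))η(t₁)) φ² = ∫_{t₁}^{t₂} ( η [ −∫(H''(F)‖∇F‖²φ² + H'(F)⟪∇F,∇φ²⟫)`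
`   + ∫ H(F)⟪b,∇φ²⟫ + ∫ (2/r)H(F)∂ᵣφ² + 2c₂ ∫ H(F(0,0,z))φ(0,0,z)² dz ] + η' ∫ H(F)φ² ) ds`.

## References

* Z. Lei, Q. S. Zhang, J. Funct. Anal. 261 (2011) = arXiv:1011.5066, §2 (2.2)–(2.3) p. 6 and the
  axis terms in the proofs of Lemma 3.2 (p. 9) and Lemma 3.4 (p. 11). [LeiZhang2011]
-/

noncomputable section

open MeasureTheory Set Function Filter Metric intervalIntegral
open _root_.Topology
open scoped InnerProductSpace RealInnerProductSpace NNReal ENNReal Laplacian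

namespace Literature.Analysis.FluidPDE

namespace LeiZhang2011

/-- **Energy identity with the axis boundary term.** Same as `energy_identity`, without the
assumptions `F = 0` on the axis and `H(0) = 0`; the axis term then carries the boundary contribution
`−2c₂ ∫ H(F(s,(0,0,z))) φ(0,0,z)² dz` (`integral_axis_term_eq_sub_boundary`), as in the proofs of
Lemmas 3.2 and 3.4 of Lei–Zhang 2011 where the solution is a nonzero constant on the axis.
Original docstring: **The energy identity (Lei–Zhang 2011, (2.2)–(2.3)) for the swirl equation in
time-integrated form.** Let, for `s ∈ [t₁, t₂]`, `F(s, ·) ∈ C²(ℝ³)` be axisymmetric scalars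
vanishing on the axis, `b(s, ·)` locally integrable drifts with `b(s, ·) = curl B(s, ·)` a.e.
for a differentiable `B(s, ·)`, for a.e. `s`, and suppose the equation holds in time-integrated
form for a.e. `x`: `F(s, x) = F(t₁, x) + ∫_{t₁}^s N(τ, x) dτ` with
`N = ΔF − DF[b] − (2/r) ∂ᵣF`. Then for `H ∈ C²` (no condition at `0`), an axisymmetric cut-off
`φ ∈ C²_c` and `η ∈ C¹`, provided the space–time integrand `(H'(F) N η + H(F) η') φ²` is
integrable on `(t₁, t₂] × ℝ³`,
`∫ (H(F(t₂)) η(t₂) − H(F(t₁)) η(t₁)) φ² = ∫_{t₁}^{t₂} (η(s) [−∫ (H''(F)‖∇F‖²φ² + H'(F)⟪∇F, ∇φ²⟫)`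
`+ ∫ H(F)⟪b, ∇φ²⟫ + ∫ (2/r) H(F) ∂ᵣ(φ²) + 2c₂ ∫ H(F(0,0,z)) φ(0,0,z)² dz] + η'(s) ∫ H(F) φ²) ds`
(`c₂ = radialConst₂ = 2π`, `(0,0,z) = meridianPoint (0,z)`). [cite: LeiZhang2011, §2 (2.2)–(2.3) p. 6 and proof of Lemma 3.2 p. 9 (axis boundary terms) (arXiv:1011.5066)] -/
theorem energy_identity_axis {F N : ℝ → EuclideanSpace ℝ (Fin 3) → ℝ}
    {b Bst : ℝ → EuclideanSpace ℝ (Fin 3) → EuclideanSpace ℝ (Fin 3)} {t₁ t₂ : ℝ} (ht : t₁ ≤ t₂)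
    (hF2 : ∀ s, ContDiff ℝ 2 (F s)) (hFa : ∀ s, IsAxisymmetricScalar (F s))
    (hb : ∀ s, LocallyIntegrable (b s) volume)
    (hBst : ∀ᵐ s ∂(volume.restrict (Ioc t₁ t₂)),
      Differentiable ℝ (Bst s) ∧ curl (Bst s) =ᵐ[volume] b s)
    (hN : ∀ s x, N s x =
      (Δ (F s)) x - fderiv ℝ (F s) x (b s x) - 2 / cylRadius x * fderiv ℝ (F s) x (eR x))
    (heq : ∀ᵐ x ∂(volume : Measure (EuclideanSpace ℝ (Fin 3))),
      IntervalIntegrable (fun s => N s x) volume t₁ t₂ ∧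
        ∀ s ∈ Icc t₁ t₂, F s x = F t₁ x + ∫ τ in t₁..s, N τ x)
    {H : ℝ → ℝ} (hH : ContDiff ℝ 2 H)
    {φ : EuclideanSpace ℝ (Fin 3) → ℝ} (hφ : ContDiff ℝ 2 φ) (hφc : HasCompactSupport φ)
    (hφa : IsAxisymmetricScalar φ) {η : ℝ → ℝ} (hη : ContDiff ℝ 1 η)
    (hint : Integrable (fun p : ℝ × EuclideanSpace ℝ (Fin 3) =>
      (deriv H (F p.1 p.2) * N p.1 p.2 * η p.1 + H (F p.1 p.2) * deriv η p.1) * φ p.2 ^ 2)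
      ((volume.restrict (Ioc t₁ t₂)).prod volume)) :
    ∫ x, (H (F t₂ x) * η t₂ - H (F t₁ x) * η t₁) * φ x ^ 2 =
      ∫ s in t₁..t₂, (η s *
        (-(∫ x, (deriv (deriv H) (F s x) * ‖gradient (F s) x‖ ^ 2 * φ x ^ 2 +
            deriv H (F s x) * ⟪gradient (F s) x, gradient (fun y => φ y ^ 2) x⟫)) +
          (∫ x, H (F s x) * ⟪b s x, gradient (fun y => φ y ^ 2) x⟫) +
          ((∫ x, 2 / cylRadius x * (H (F s x) * fderiv ℝ (fun y => φ y ^ 2) x (eR x))) +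
            2 * radialConst₂ * ∫ z : ℝ, H (F s (meridianPoint (0, z))) * φ (meridianPoint (0, z)) ^ 2)) +
        deriv η s * ∫ x, H (F s x) * φ x ^ 2) := by
  -- Step 1: the integrated chain rule in time, under `∫ … φ² dx`
  have h1 := integral_comp_mul_sub_eq_integral_integral_ae (μ := volume) ht heq
    (hH.of_le one_le_two) hη (fun x => φ x ^ 2) hint
  rw [h1]
  -- Step 2: the slice identities, for a.e. `s ∈ (t₁, t₂]`
  have hH1 : ContDiff ℝ 1 H := hH.of_le one_le_two
  have hH' : ContDiff ℝ 1 (deriv H) := by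
    have h2 : ContDiff ℝ (1 + 1) H := by rw [one_add_one_eq_two]; exact hH
    exact h2.deriv'
  have hφ1 : ContDiff ℝ 1 φ := hφ.of_le one_le_two
  have hφ2c : HasCompactSupport fun y => φ y ^ 2 :=
    hφc.comp_left (g := fun t : ℝ => t ^ 2) (by simp)
  -- integrability of the slices of the space–time integrand
  have hslice : ∀ᵐ s ∂(volume.restrict (Ioc t₁ t₂)), Integrable (fun x =>
      (deriv H (F s x) * N s x * η s + H (F s x) * deriv η s) * φ x ^ 2)
      (volume : Measure (EuclideanSpace ℝ (Fin 3))) :=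
    hint.prod_right_ae
  have hae : ∀ᵐ s ∂(volume.restrict (Ioc t₁ t₂)),
      ∫ x, (deriv H (F s x) * N s x * η s + H (F s x) * deriv η s) * φ x ^ 2 =
        η s * (-(∫ x, (deriv (deriv H) (F s x) * ‖gradient (F s) x‖ ^ 2 * φ x ^ 2 +
            deriv H (F s x) * ⟪gradient (F s) x, gradient (fun y => φ y ^ 2) x⟫)) +
          (∫ x, H (F s x) * ⟪b s x, gradient (fun y => φ y ^ 2) x⟫) +
          ((∫ x, 2 / cylRadius x * (H (F s x) * fderiv ℝ (fun y => φ y ^ 2) x (eR x))) +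
            2 * radialConst₂ * ∫ z : ℝ, H (F s (meridianPoint (0, z))) * φ (meridianPoint (0, z)) ^ 2)) +
        deriv η s * ∫ x, H (F s x) * φ x ^ 2 := by
    filter_upwards [hBst, hslice] with s hBs hsl
    obtain ⟨hBd, hBcurl⟩ := hBs
    -- the three pieces of `∫ H'(F) N φ²` and their integrability
    set P₁ : EuclideanSpace ℝ (Fin 3) → ℝ := fun x => deriv H (F s x) * φ x ^ 2 * (Δ (F s)) x
      with hP₁
    set P₂ : EuclideanSpace ℝ (Fin 3) → ℝ := fun x =>
      ⟪b s x, gradient (F s) x⟫ * (deriv H (F s x) * φ x ^ 2) with hP₂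
    set P₃ : EuclideanSpace ℝ (Fin 3) → ℝ := fun x =>
      2 / cylRadius x * (fderiv ℝ (F s) x (eR x) * (deriv H (F s x) * φ x ^ 2)) with hP₃
    set P₄ : EuclideanSpace ℝ (Fin 3) → ℝ := fun x => H (F s x) * φ x ^ 2 with hP₄
    have hHF : Continuous fun x => deriv H (F s x) :=
      (hH.continuous_deriv (by norm_num)).comp (hF2 s).continuous
    have hσc : Continuous fun x => deriv H (F s x) * φ x ^ 2 := hHF.mul (hφ.continuous.pow 2)
    have hσcs : HasCompactSupport fun x => deriv H (F s x) * φ x ^ 2 := hφ2c.mul_left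
    -- `P₁` : continuous with compact support
    have hΔc : Continuous (Δ (F s)) := by
      have h2 : ContDiff ℝ ((0 : ℕ∞) + 2 : ℕ∞) (F s) := by simpa using hF2 s
      exact (contDiff_laplacian (n := 0) h2).continuous
    have hiP₁ : Integrable P₁ (volume : Measure (EuclideanSpace ℝ (Fin 3))) :=
      (hσc.mul hΔc).integrable_of_hasCompactSupport hσcs.mul_right
    -- `P₂` : locally integrable drift against a continuous compactly supported field
    have hgradF : Continuous (gradient (F s)) := continuous_gradient_of_contDiff ((hF2 s).of_le one_le_two)
    have hW : Continuous fun x => (deriv H (F s x) * φ x ^ 2) • gradient (F s) x := hσc.smul hgradF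
    have hWcs : HasCompactSupport fun x => (deriv H (F s x) * φ x ^ 2) • gradient (F s) x :=
      hσcs.smul_right
    have hiP₂ : Integrable P₂ (volume : Measure (EuclideanSpace ℝ (Fin 3))) := by
      have h := integrable_inner_of_locallyIntegrable (hb s) hW hWcs
      refine h.congr (Eventually.of_forall fun x => ?_)
      simp only [hP₂, inner_smul_right]
      ring
    -- `P₃` : the axis term, with its boundary contribution
    have hφ2C : ContDiff ℝ 1 fun y => φ y ^ 2 := hφ1.pow 2
    obtain ⟨hiP₃, -, e₃⟩ := integral_axis_term_eq_sub_boundary ((hF2 s).of_le one_le_two) (hFa s) hH1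
      hφ1 hφc hφa
    -- `P₄`
    have hiP₄ : Integrable P₄ (volume : Measure (EuclideanSpace ℝ (Fin 3))) :=
      ((hH.continuous.comp (hF2 s).continuous).mul (hφ.continuous.pow 2)).integrable_of_hasCompactSupport
        hφ2c.mul_left
    -- pointwise: the integrand is `η s (P₁ − P₂ − P₃) + η' s P₄`
    have hpt : ∀ x, (deriv H (F s x) * N s x * η s + H (F s x) * deriv η s) * φ x ^ 2 =
        η s * (P₁ x - P₂ x - P₃ x) + deriv η s * P₄ x := by
      intro x
      simp only [hP₁, hP₂, hP₃, hP₄, hN s x, ← inner_gradient_left (F s) x (b s x),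
        real_inner_comm (b s x)]
      ring
    simp_rw [hpt]
    rw [integral_add (((hiP₁.sub' hiP₂).sub' hiP₃).const_mul (η s)) (hiP₄.const_mul (deriv η s)),
      MeasureTheory.integral_const_mul, MeasureTheory.integral_const_mul,
      integral_sub (hiP₁.sub' hiP₂) hiP₃,
      integral_sub hiP₁ hiP₂]
    -- the slice identities
    have e₁ : ∫ x, P₁ x = -∫ x, (deriv (deriv H) (F s x) * ‖gradient (F s) x‖ ^ 2 * φ x ^ 2 +
        deriv H (F s x) * ⟪gradient (F s) x, gradient (fun y => φ y ^ 2) x⟫) :=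
      integral_laplacian_mul_deriv_comp_mul_sq (hF2 s) hH hφ1 hφc
    have e₂ : ∫ x, P₂ x = -∫ x, H (F s x) * ⟪b s x, gradient (fun y => φ y ^ 2) x⟫ :=
      integral_inner_gradient_mul_deriv_comp_mul_sq hBd hBcurl (hb s) (hF2 s) hH hφ hφc
    rw [e₁, e₂]
    rw [show (∫ x, P₃ x) = (-∫ x, 2 / cylRadius x * (H (F s x) * fderiv ℝ (fun y => φ y ^ 2) x (eR x))) -
        2 * radialConst₂ * ∫ z : ℝ, H (F s (meridianPoint (0, z))) * φ (meridianPoint (0, z)) ^ 2 from e₃]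
    ring
  -- Step 3: replace the inner integrals for a.e. `s`
  refine intervalIntegral.integral_congr_ae ?_
  rw [uIoc_of_le ht]
  exact (ae_restrict_iff' measurableSet_Ioc).1 hae

end LeiZhang2011

end Literature.Analysis.FluidPDE
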